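import Literature.AlgebraicGeometry.HodgeTheory.AbelianVarietyIsotypicComponents
import Literature.AlgebraicGeometry.Motives.AbelianVarietySubvarietyFactorisationAnyField
import HarnessLib

/-!
# The isotypic components are UNIQUE as abelian subvarieties: every homomorphism from an abelian variety of type `B_q`
# into `X` factors through the component `Y_q ↪ X`, which is therefore the maximal type-`B_q` abelian subvariety of `X`,
# unique up to a unique isomorphism over `X`, and equal to the sum `Σ_f f(B_q)` of the images of all `f : B_q → X`
# (Silverberg–Zarhin 2015 Def. 2.2–2.3, Lemma 3.3; Mumford §19 Cor. 1–2; Milne 1986 §12)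

Layer `Literature/AlgebraicGeometry/HodgeTheory`; theorems only (no `def`, no instance, no named fact; net debt 0).  §1 holds
over ANY field, §§2–4 over a PERFECT field.  Sequel of `HodgeTheory/AbelianVarietyIsotypicComponents` (seat p03 GEN 50: the
components `i_q : Y_q ↪ X`, `Y_q ∼ B_q^{n_q+1}` for pairwise non-isogenous simple `B_q`, addition map `⨁_q Y_q → X` an
isogeny, `Hom(Y_q, Y_{q'}) = 0` for `q ≠ q'`) and of `Motives/AbelianVarietySubvarietyFactorisationAnyField` (factorisation
through an abelian subvariety is detected on the underlying topological spaces; `N • j = g₀ ≫ i ⟹ j` factors through `i`).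

THE PRINT.  A. Silverberg, Yu. G. Zarhin, *Isogenies of abelian varieties over finite fields*, Des. Codes Cryptogr. 77
(2015), held as `paper:arxiv-1409.0592`: Def. 2.2 (p. 3 L80) «An `F`-isotypic abelian variety is a positive dimensional
abelian variety defined over a field `F` that is `F`-isogenous to a power of an `F`-simple abelian variety»; Def. 2.3 (p. 3
L85) «If `X` is an abelian variety over a field `F`, an `F`-isotypic component of `X` is a maximal `F`-isotypic abelian
subvariety of `X`»; proof of Lemma 3.3 (p. 5 L34–L40) «It follows easily from the Poincaré complete reducibility theorem that
the set `I_A(F)` is finite and the natural `F`-homomorphism `S : ∏_{X ∈ I_A(F)} X → A`, `{a_X} ↦ Σ a_X` is an `F`-isogeny.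
Since `Hom_F(X, Y) = 0` when `X, Y ∈ I_A(F)` and `X ≠ Y` …».  Mumford §19 Cor. 1–2 of Thm. 1 (pp. 173–174), Milne 1986 §12
p. 122 (PDF p. 189): `X ∼ ∏ A_i^{r_i}`, the `A_i` unique up to isogeny, `End⁰(X) = ∏ End⁰(A_i^{r_i})`.

THE ARGUMENT (§1, any field).  Let `i_q : Y_q → X` be homomorphisms whose addition map `d = desc i : ⨁_q Y_q → X` is an
isogeny, `v` a quasi-inverse (`v ≫ d = n • 𝟙 X`, `n ≥ 1`), and `j : Z → X` a homomorphism with `Hom(Z, Y_{q'}) = 0` for all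
`q' ≠ q`.  Then `j ≫ v : Z → ⨁ Y` has only its `q`-th component `g₀ = j ≫ v ≫ π_q`, so `n • j = j ≫ v ≫ d = g₀ ≫ i_q`,
and `j` factors (uniquely) through the abelian subvariety `i_q` by `existsUnique_hom_comp_eq_of_nsmul_eq_comp`.  Over a
perfect field (§2) the orthogonality holds for every `Z ∼ B_q^{s+1}` against the isotypic components of the other types
(`hom_eq_zero_of_isIsogenous_biproduct_const_of_ne`); uniqueness (§3) is mutual factorisation of two systems of components;
§4: for a family `f_l : B_q → X` spanning `Hom(B_q, X)` over `ℤ`, every `f_l` lands in `Y_q`, and conversely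
`Y_q ↞ ⨁_k B_q` (an isogeny `e`) with `ι_k ≫ e ≫ i_q = Σ_l a_{kl} f_l`, so that `e ≫ i_q` factors through the addition map
of the `f_l` by the integer matrix `(a_{kl})` — the two ranges agree and `Y_q ≅ im(⨁_l B_q → X)` over `X`.

Results (namespace `Literature.AlgebraicGeometry.HodgeTheory.AbelianVariety`):
* §1 (any field) **`existsUnique_hom_comp_eq_of_isIsogeny_desc_of_hom_eq_zero`** (factorisation through a summand of an
  addition-map isogeny by `Hom`-orthogonality), `range_subset_range_of_isIsogeny_desc_of_hom_eq_zero`;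
* §2 (perfect field; `B_q` simple pairwise non-isogenous of positive dimension, `i_q : Y_q ↪ X` closed immersions with
  `Y_q ∼ B_q^{n_q+1}` and `desc i` an isogeny; `Z ∼ B_q^{s+1}`) **`existsUnique_hom_comp_isotypicComponent_eq`** (every
  `j : Z → X` factors uniquely through `i_q`), `range_subset_range_isotypicComponent`,
  **`exists_isClosedImmersion_comp_isotypicComponent_eq`** (every type-`B_q` abelian subvariety of `X` lies in `Y_q`:
  MAXIMALITY), `dim_le_dim_isotypicComponent_of_isFinite`, `le_multiplicity_of_isFinite` (`Z ∼ B_q^{s+1}` with a finite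
  homomorphism to `X` has `s ≤ n_q`), `existsUnique_hom_comp_isotypicComponent_eq_of_isIsogenous` (simple `S ∼ B_q`);
* §3 **`exists_iso_isotypicComponents_comp_eq`** (two systems of isotypic components of `X` over the same types are
  isomorphic over `X`), `range_isotypicComponents_eq`, **`multiplicity_isotypicComponents_eq`** (`n_q = n'_q`),
  `existsUnique_hom_isotypicComponents_comp_eq` (the comparison over `X` is unique, and an isomorphism),
  **`exists_iso_isotypicComponents_comp_eq_of_isIsogenous`** (systems indexed by two lists of types: components of
  isogenous types agree);
* §4 `range_subset_range_isotypicComponent_of_hom` (every `f : B_q → X` lands in `Y_q`),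
  `range_biproduct_desc_subset_range_isotypicComponent`, **`range_isotypicComponent_eq_range_biproduct_desc_of_span_eq_top`**
  and **`exists_iso_image_biproduct_desc_isotypicComponent`** (`Y_q ≅ im(⨁_l B_q → X)` over `X` for any finite family
  `f_l` spanning `Hom(B_q, X)` over `ℤ`), **`exists_fin_iso_image_biproduct_desc_isotypicComponent`** (such a family exists:
  `Y_q` is the sum of the images of all homomorphisms `B_q → X` — the INTRINSIC description of the isotypic component).

## References
* [SilverbergZarhin2015] A. Silverberg, Yu. G. Zarhin, *Isogenies of abelian varieties over finite fields*, Des. Codes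
  Cryptogr. 77 (2015) 427–439 (arXiv:1409.0592), Def. 2.2–2.3 (p. 3), Lemma 3.1, Def. 3.2, Lemma 3.3 and its proof (p. 5).
* [MumfordAV1970] D. Mumford, *Abelian Varieties* (1970), §19 Thm. 1, Cor. 1–2 and Remark p. 169 (pp. 169–174).
* [Milne1986AbelianVarieties] J. S. Milne, *Abelian Varieties*, in Cornell–Silverman, *Arithmetic Geometry* (1986), §12
  Prop. 12.1 and p. 122 (PDF p. 189).
* [LangeRodriguez2022] H. Lange, R. E. Rodríguez, *Decomposition of Jacobians by Prym Varieties*, LNM 2310 (2022), Thm. 2.7.1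
  (PDF p. 38), §2.9 (PDF pp. 43–45: «the abelian subvarieties `A^{e_i}` are uniquely determined»).
* [GortzWedhorn2020] U. Görtz, T. Wedhorn, *Algebraic Geometry I: Schemes*, 2nd ed. (2020), Remark 10.32 (PDF p. 312),
  Cor. 16.56 (1) (PDF p. 678).
-/

noncomputable section

universe u

open CategoryTheory CategoryTheory.Limits

namespace Literature.AlgebraicGeometry.HodgeTheory

namespace AbelianVariety

open _root_.AlgebraicGeometry
open Literature.AlgebraicGeometry.Motives Literature.AlgebraicGeometry.Motives.AbelianVariety

variable {K : Type u} [Field K]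

/-! ## §1 Factorisation through a summand of an addition-map isogeny by `Hom`-orthogonality (any field) -/

section AnyField

variable {Q : Type} [Fintype Q] {X Z : Motives.AbelianVariety K} {Y : Q → Motives.AbelianVariety K}

/-- **Factorisation through a summand of an addition-map isogeny** (any field): let `i_q : Y_q → X` be homomorphisms
whose addition map `⨁_q Y_q → X` is an isogeny, `i_q` a closed immersion, and `j : Z → X` a homomorphism with
`Hom(Z, Y_{q'}) = 0` for every `q' ≠ q`; then `j` factors UNIQUELY through `i_q`.  (With a quasi-inverse `v` of the
addition map, `n • j = (j ≫ v ≫ π_q) ≫ i_q`.) [cite: SilverbergZarhin2015, Def. 2.3 and proof of Lemma 3.3 (p. 5: «S is an F-isogeny … Hom_F(X, Y) = 0»)]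
[cite: MumfordAV1970, §19 Remark p. 169 and Cor. 2 of Thm. 1 (p. 174)] -/
theorem existsUnique_hom_comp_eq_of_isIsogeny_desc_of_hom_eq_zero (i : ∀ q, Y q ⟶ X) (q : Q)
    [IsClosedImmersion (Hom.toSchemeHom (i q))] (hdesc : IsIsogeny (biproduct.desc i)) (j : Z ⟶ X)
    (horth : ∀ q', q' ≠ q → ∀ f : Z ⟶ Y q', f = 0) : ∃! g : Z ⟶ Y q, g ≫ i q = j := by
  classical
  obtain ⟨v, n, hn, -, hvd⟩ := IsIsogeny.exists_nsmul_inverse_holds hdesc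
  -- `j ≫ v` has only its `q`-th component
  have hsplit : j ≫ v = ∑ q', ((j ≫ v) ≫ biproduct.π Y q') ≫ biproduct.ι Y q' := by
    conv_lhs => rw [← Category.comp_id (j ≫ v), ← biproduct.total, Preadditive.comp_sum]
    exact Finset.sum_congr rfl fun q' _ ↦ (Category.assoc _ _ _).symm
  have hsingle : j ≫ v = ((j ≫ v) ≫ biproduct.π Y q) ≫ biproduct.ι Y q := by
    conv_lhs => rw [hsplit, Finset.sum_eq_single q (fun q' _ hq' ↦ by
      rw [Category.assoc j v, horth q' hq' (j ≫ v ≫ biproduct.π Y q'), zero_comp]) (fun h ↦ absurd (Finset.mem_univ q) h)]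
  refine existsUnique_hom_comp_eq_of_nsmul_eq_comp j (i q) hn.ne' ((j ≫ v) ≫ biproduct.π Y q) ?_
  calc n • j = j ≫ (v ≫ biproduct.desc i) := by rw [hvd, Preadditive.comp_nsmul, Category.comp_id]
    _ = (j ≫ v) ≫ biproduct.desc i := by rw [Category.assoc]
    _ = ((j ≫ v) ≫ biproduct.π Y q) ≫ i q := by
          conv_lhs => rw [hsingle]
          rw [Category.assoc _ (biproduct.ι Y q), biproduct.ι_desc]

/-- Range form of the previous factorisation: `range j ⊆ range i_q`. [cite: SilverbergZarhin2015, Def. 2.3 and proof of Lemma 3.3 (p. 5)]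
[cite: GortzWedhorn2020, Remark 10.32 (PDF p. 312)] -/
theorem range_subset_range_of_isIsogeny_desc_of_hom_eq_zero (i : ∀ q, Y q ⟶ X) (q : Q)
    [IsClosedImmersion (Hom.toSchemeHom (i q))] (hdesc : IsIsogeny (biproduct.desc i)) (j : Z ⟶ X)
    (horth : ∀ q', q' ≠ q → ∀ f : Z ⟶ Y q', f = 0) :
    Set.range (Hom.toSchemeHom j) ⊆ Set.range (Hom.toSchemeHom (i q)) := by
  obtain ⟨g, hg, -⟩ := existsUnique_hom_comp_eq_of_isIsogeny_desc_of_hom_eq_zero i q hdesc j horth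
  exact range_toSchemeHom_subset_of_comp_eq (i q) j g hg

end AnyField

/-! ## §2 Every homomorphism from a type-`B_q` abelian variety lands in the isotypic component `Y_q` (perfect field) -/

section Perfect

variable [PerfectField K] {Q : Type} [Fintype Q] {B : Q → Motives.AbelianVariety K} {n : Q → ℕ}
  {X Z S : Motives.AbelianVariety K} {Y : Q → Motives.AbelianVariety K}

/-- **Every homomorphism from an abelian variety of type `B_q` into `X` factors UNIQUELY through the isotypic component
`i_q : Y_q ↪ X`** (perfect field): for pairwise non-isogenous simple `B_q` of positive dimension, abelian subvarieties
`i_q : Y_q ↪ X` with `Y_q ∼ B_q^{n_q+1}` whose addition map is an isogeny, and `Z ∼ B_q^{s+1}`, every `j : Z → X` is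
`g ≫ i_q` for a unique `g : Z → Y_q` (`Hom(Z, Y_{q'}) = 0` for `q' ≠ q`, §1).
[cite: SilverbergZarhin2015, Def. 2.2–2.3 (p. 3) and proof of Lemma 3.3 (p. 5)] [cite: MumfordAV1970, §19 Cor. 1–2 of Thm. 1 (pp. 173–174)]
[cite: Milne1986AbelianVarieties, §12 p. 122 (PDF p. 189)] -/
theorem existsUnique_hom_comp_isotypicComponent_eq (hB : ∀ q, (B q).IsSimple) (hB0 : ∀ q, 0 < (B q).dim)
    (hni : ∀ q q', q ≠ q' → ¬ IsIsogenous (B q) (B q')) (hY : ∀ q, IsIsogenous (Y q) (⨁ fun _ : Fin (n q + 1) ↦ B q))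
    (i : ∀ q, Y q ⟶ X) (hi : ∀ q, IsClosedImmersion (Hom.toSchemeHom (i q))) (hdesc : IsIsogeny (biproduct.desc i))
    {q : Q} {s : ℕ} (hZ : IsIsogenous Z (⨁ fun _ : Fin (s + 1) ↦ B q)) (j : Z ⟶ X) :
    ∃! g : Z ⟶ Y q, g ≫ i q = j :=
  haveI := hi q
  existsUnique_hom_comp_eq_of_isIsogeny_desc_of_hom_eq_zero i q hdesc j fun q' hq' f ↦
    hom_eq_zero_of_isIsogenous_biproduct_const_of_ne hB hB0 hni (Ne.symm hq') hZ (hY q') f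

/-- `range j ⊆ range i_q` for every homomorphism `j : Z → X` from `Z ∼ B_q^{s+1}` (perfect field).
[cite: SilverbergZarhin2015, Def. 2.3 and proof of Lemma 3.3 (p. 5)] [cite: GortzWedhorn2020, Remark 10.32 (PDF p. 312)] -/
theorem range_subset_range_isotypicComponent (hB : ∀ q, (B q).IsSimple) (hB0 : ∀ q, 0 < (B q).dim)
    (hni : ∀ q q', q ≠ q' → ¬ IsIsogenous (B q) (B q')) (hY : ∀ q, IsIsogenous (Y q) (⨁ fun _ : Fin (n q + 1) ↦ B q))
    (i : ∀ q, Y q ⟶ X) (hi : ∀ q, IsClosedImmersion (Hom.toSchemeHom (i q))) (hdesc : IsIsogeny (biproduct.desc i))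
    {q : Q} {s : ℕ} (hZ : IsIsogenous Z (⨁ fun _ : Fin (s + 1) ↦ B q)) (j : Z ⟶ X) :
    Set.range (Hom.toSchemeHom j) ⊆ Set.range (Hom.toSchemeHom (i q)) := by
  obtain ⟨g, hg, -⟩ := existsUnique_hom_comp_isotypicComponent_eq hB hB0 hni hY i hi hdesc hZ j
  exact range_toSchemeHom_subset_of_comp_eq (i q) j g hg

/-- **MAXIMALITY: every abelian subvariety of `X` of type `B_q` is contained in the isotypic component `Y_q`** (perfect
field): a closed-immersion homomorphism `j : Z ↪ X` with `Z ∼ B_q^{s+1}` is `g ≫ i_q` for a closed immersion `g : Z ↪ Y_q`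
— Silverberg–Zarhin's «an `F`-isotypic component of `X` is a maximal `F`-isotypic abelian subvariety of `X`» holds for the
components `Y_q`. [cite: SilverbergZarhin2015, Def. 2.2–2.3 (p. 3) and proof of Lemma 3.3 (p. 5)]
[cite: MumfordAV1970, §19 Cor. 1–2 of Thm. 1 (pp. 173–174)] -/
theorem exists_isClosedImmersion_comp_isotypicComponent_eq (hB : ∀ q, (B q).IsSimple) (hB0 : ∀ q, 0 < (B q).dim)
    (hni : ∀ q q', q ≠ q' → ¬ IsIsogenous (B q) (B q')) (hY : ∀ q, IsIsogenous (Y q) (⨁ fun _ : Fin (n q + 1) ↦ B q))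
    (i : ∀ q, Y q ⟶ X) (hi : ∀ q, IsClosedImmersion (Hom.toSchemeHom (i q))) (hdesc : IsIsogeny (biproduct.desc i))
    {q : Q} {s : ℕ} (hZ : IsIsogenous Z (⨁ fun _ : Fin (s + 1) ↦ B q)) (j : Z ⟶ X)
    [IsClosedImmersion (Hom.toSchemeHom j)] :
    ∃ g : Z ⟶ Y q, IsClosedImmersion (Hom.toSchemeHom g) ∧ g ≫ i q = j := by
  haveI := hi q
  obtain ⟨g, hg, -⟩ := existsUnique_hom_comp_isotypicComponent_eq hB hB0 hni hY i hi hdesc hZ j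
  exact ⟨g, isClosedImmersion_of_comp_eq_of_isClosedImmersion j (i q) g hg, hg⟩

/-- An abelian variety `Z ∼ B_q^{s+1}` with a FINITE homomorphism `j : Z → X` (e.g. an abelian subvariety of type `B_q`)
has `dim Z ≤ dim Y_q` (perfect field; the factor `Z → Y_q` of `j` is finite). [cite: SilverbergZarhin2015, Def. 2.3 and proof of Lemma 3.3 (p. 5)]
[cite: Milne1986AbelianVarieties, §8 Prop. 8.1 (PDF p. 180) and §12 p. 122 (PDF p. 189)] -/
theorem dim_le_dim_isotypicComponent_of_isFinite (hB : ∀ q, (B q).IsSimple) (hB0 : ∀ q, 0 < (B q).dim)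
    (hni : ∀ q q', q ≠ q' → ¬ IsIsogenous (B q) (B q')) (hY : ∀ q, IsIsogenous (Y q) (⨁ fun _ : Fin (n q + 1) ↦ B q))
    (i : ∀ q, Y q ⟶ X) (hi : ∀ q, IsClosedImmersion (Hom.toSchemeHom (i q))) (hdesc : IsIsogeny (biproduct.desc i))
    {q : Q} {s : ℕ} (hZ : IsIsogenous Z (⨁ fun _ : Fin (s + 1) ↦ B q)) (j : Z ⟶ X) [IsFinite (Hom.toSchemeHom j)] :
    Z.dim ≤ (Y q).dim := by
  obtain ⟨g, hg, -⟩ := existsUnique_hom_comp_isotypicComponent_eq hB hB0 hni hY i hi hdesc hZ j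
  haveI : IsFinite (Hom.toSchemeHom (g ≫ i q)) := by rw [hg]; infer_instance
  haveI : IsFinite (Hom.toSchemeHom g) := isFinite_of_isFinite_comp g (i q)
  exact dim_le_of_isFinite g

/-- **`s ≤ n_q`**: an abelian variety `Z ∼ B_q^{s+1}` with a finite homomorphism to `X` (e.g. an abelian subvariety of `X` of
type `B_q`) has at most the multiplicity `n_q + 1` of `B_q` in `X` (perfect field; `dim Z = (s+1) dim B_q ≤ dim Y_q =
(n_q+1) dim B_q`). [cite: SilverbergZarhin2015, Def. 2.3 and proof of Lemma 3.3 (p. 5)] [cite: MumfordAV1970, §19 Cor. 1 of Thm. 1 (p. 173)] -/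
theorem le_multiplicity_of_isFinite (hB : ∀ q, (B q).IsSimple) (hB0 : ∀ q, 0 < (B q).dim)
    (hni : ∀ q q', q ≠ q' → ¬ IsIsogenous (B q) (B q')) (hY : ∀ q, IsIsogenous (Y q) (⨁ fun _ : Fin (n q + 1) ↦ B q))
    (i : ∀ q, Y q ⟶ X) (hi : ∀ q, IsClosedImmersion (Hom.toSchemeHom (i q))) (hdesc : IsIsogeny (biproduct.desc i))
    {q : Q} {s : ℕ} (hZ : IsIsogenous Z (⨁ fun _ : Fin (s + 1) ↦ B q)) (j : Z ⟶ X) [IsFinite (Hom.toSchemeHom j)] :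
    s ≤ n q := by
  have h := dim_le_dim_isotypicComponent_of_isFinite hB hB0 hni hY i hi hdesc hZ j
  rw [hZ.dim_eq, (hY q).dim_eq, dim_biproduct_const, dim_biproduct_const, Fintype.card_fin, Fintype.card_fin] at h
  have h' := Nat.le_of_mul_le_mul_right h (hB0 q)
  omega

/-- A SIMPLE abelian variety isogenous to `B_q` (e.g. `B_q` itself) maps into `X` only through `Y_q`: every `j : S → X`
with `S ∼ B_q` factors uniquely through `i_q` (perfect field). [cite: SilverbergZarhin2015, Def. 2.2–2.3 (p. 3) and proof of Lemma 3.3 (p. 5)]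
[cite: MumfordAV1970, §19 Cor. 1–2 of Thm. 1 (pp. 173–174)] -/
theorem existsUnique_hom_comp_isotypicComponent_eq_of_isIsogenous (hB : ∀ q, (B q).IsSimple)
    (hB0 : ∀ q, 0 < (B q).dim) (hni : ∀ q q', q ≠ q' → ¬ IsIsogenous (B q) (B q'))
    (hY : ∀ q, IsIsogenous (Y q) (⨁ fun _ : Fin (n q + 1) ↦ B q)) (i : ∀ q, Y q ⟶ X)
    (hi : ∀ q, IsClosedImmersion (Hom.toSchemeHom (i q))) (hdesc : IsIsogeny (biproduct.desc i)) {q : Q}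
    (hS : IsIsogenous S (B q)) (j : S ⟶ X) : ∃! g : S ⟶ Y q, g ≫ i q = j := by
  have h1 : IsIsogenous (B q) (⨁ fun _ : Fin 1 ↦ B q) :=
    ⟨(biproductUniqueIso (fun _ : Fin 1 ↦ B q)).inv, isIsogeny_hom_of_iso (biproductUniqueIso _).symm⟩
  exact existsUnique_hom_comp_isotypicComponent_eq (s := 0) hB hB0 hni hY i hi hdesc (hS.trans h1) j

/-! ## §3 Uniqueness of the isotypic components up to a unique isomorphism over `X` -/

variable {Y' : Q → Motives.AbelianVariety K} {n' : Q → ℕ}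

/-- **Two systems of isotypic components of `X` over the same simple types are isomorphic over `X`** (perfect field): if
`i_q : Y_q ↪ X` (`Y_q ∼ B_q^{n_q+1}`) and `i'_q : Y'_q ↪ X` (`Y'_q ∼ B_q^{n'_q+1}`) are abelian subvarieties whose addition
maps are isogenies, then `Y_q ≅ Y'_q` over `X` for every `q` — Silverberg–Zarhin's isotypic components are well defined.
[cite: SilverbergZarhin2015, Def. 2.3, Def. 3.2 and proof of Lemma 3.3 (p. 5)] [cite: LangeRodriguez2022, §2.9 (PDF p. 45: «the abelian subvarieties A^{e_i} are uniquely determined»)]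
[cite: MumfordAV1970, §19 Cor. 1 of Thm. 1 (p. 173)] -/
theorem exists_iso_isotypicComponents_comp_eq (hB : ∀ q, (B q).IsSimple) (hB0 : ∀ q, 0 < (B q).dim)
    (hni : ∀ q q', q ≠ q' → ¬ IsIsogenous (B q) (B q'))
    (hY : ∀ q, IsIsogenous (Y q) (⨁ fun _ : Fin (n q + 1) ↦ B q)) (i : ∀ q, Y q ⟶ X)
    (hi : ∀ q, IsClosedImmersion (Hom.toSchemeHom (i q))) (hdesc : IsIsogeny (biproduct.desc i))
    (hY' : ∀ q, IsIsogenous (Y' q) (⨁ fun _ : Fin (n' q + 1) ↦ B q)) (i' : ∀ q, Y' q ⟶ X)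
    (hi' : ∀ q, IsClosedImmersion (Hom.toSchemeHom (i' q))) (hdesc' : IsIsogeny (biproduct.desc i')) (q : Q) :
    ∃ e : Y q ≅ Y' q, e.hom ≫ i' q = i q := by
  haveI := hi q
  haveI := hi' q
  exact exists_iso_of_range_eq (i q) (i' q)
    ((range_subset_range_isotypicComponent hB hB0 hni hY' i' hi' hdesc' (hY q) (i q)).antisymm
      (range_subset_range_isotypicComponent hB hB0 hni hY i hi hdesc (hY' q) (i' q)))

/-- Two systems of isotypic components have the same underlying closed subsets of `X`.
[cite: SilverbergZarhin2015, Def. 2.3 and proof of Lemma 3.3 (p. 5)] [cite: GortzWedhorn2020, Remark 10.32 (PDF p. 312)] -/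
theorem range_isotypicComponents_eq (hB : ∀ q, (B q).IsSimple) (hB0 : ∀ q, 0 < (B q).dim)
    (hni : ∀ q q', q ≠ q' → ¬ IsIsogenous (B q) (B q'))
    (hY : ∀ q, IsIsogenous (Y q) (⨁ fun _ : Fin (n q + 1) ↦ B q)) (i : ∀ q, Y q ⟶ X)
    (hi : ∀ q, IsClosedImmersion (Hom.toSchemeHom (i q))) (hdesc : IsIsogeny (biproduct.desc i))
    (hY' : ∀ q, IsIsogenous (Y' q) (⨁ fun _ : Fin (n' q + 1) ↦ B q)) (i' : ∀ q, Y' q ⟶ X)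
    (hi' : ∀ q, IsClosedImmersion (Hom.toSchemeHom (i' q))) (hdesc' : IsIsogeny (biproduct.desc i')) (q : Q) :
    Set.range (Hom.toSchemeHom (i q)) = Set.range (Hom.toSchemeHom (i' q)) :=
  (range_subset_range_isotypicComponent hB hB0 hni hY' i' hi' hdesc' (hY q) (i q)).antisymm
    (range_subset_range_isotypicComponent hB hB0 hni hY i hi hdesc (hY' q) (i' q))

/-- **The multiplicities are unique**: two systems of isotypic components over the same simple types have `n_q = n'_q`
(«the `r_i` are uniquely determined»). [cite: Milne1986AbelianVarieties, §12 p. 122 (PDF p. 189)]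
[cite: MumfordAV1970, §19 Cor. 1 of Thm. 1 (p. 173)] [cite: SilverbergZarhin2015, proof of Lemma 3.3 (p. 5)] -/
theorem multiplicity_isotypicComponents_eq (hB : ∀ q, (B q).IsSimple) (hB0 : ∀ q, 0 < (B q).dim)
    (hni : ∀ q q', q ≠ q' → ¬ IsIsogenous (B q) (B q'))
    (hY : ∀ q, IsIsogenous (Y q) (⨁ fun _ : Fin (n q + 1) ↦ B q)) (i : ∀ q, Y q ⟶ X)
    (hi : ∀ q, IsClosedImmersion (Hom.toSchemeHom (i q))) (hdesc : IsIsogeny (biproduct.desc i))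
    (hY' : ∀ q, IsIsogenous (Y' q) (⨁ fun _ : Fin (n' q + 1) ↦ B q)) (i' : ∀ q, Y' q ⟶ X)
    (hi' : ∀ q, IsClosedImmersion (Hom.toSchemeHom (i' q))) (hdesc' : IsIsogeny (biproduct.desc i')) (q : Q) :
    n q = n' q := by
  obtain ⟨e, -⟩ := exists_iso_isotypicComponents_comp_eq hB hB0 hni hY i hi hdesc hY' i' hi' hdesc' q
  have h := dim_eq_of_isIsogeny (isIsogeny_hom_of_iso e)
  rw [(hY q).dim_eq, (hY' q).dim_eq, dim_biproduct_const, dim_biproduct_const, Fintype.card_fin, Fintype.card_fin] at h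
  have h' := Nat.eq_of_mul_eq_mul_right (hB0 q) h
  omega

/-- The comparison of two systems of isotypic components over `X` is UNIQUE and an isomorphism: there is exactly one
`g : Y_q → Y'_q` with `g ≫ i'_q = i_q`, and it is an isomorphism. [cite: SilverbergZarhin2015, Def. 2.3 and proof of Lemma 3.3 (p. 5)]
[cite: GortzWedhorn2020, Remark 10.32 (PDF p. 312) and Cor. 16.56 (1) (PDF p. 678)] -/
theorem existsUnique_hom_isotypicComponents_comp_eq (hB : ∀ q, (B q).IsSimple) (hB0 : ∀ q, 0 < (B q).dim)
    (hni : ∀ q q', q ≠ q' → ¬ IsIsogenous (B q) (B q'))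
    (hY : ∀ q, IsIsogenous (Y q) (⨁ fun _ : Fin (n q + 1) ↦ B q)) (i : ∀ q, Y q ⟶ X)
    (hi : ∀ q, IsClosedImmersion (Hom.toSchemeHom (i q))) (hdesc : IsIsogeny (biproduct.desc i))
    (hY' : ∀ q, IsIsogenous (Y' q) (⨁ fun _ : Fin (n' q + 1) ↦ B q)) (i' : ∀ q, Y' q ⟶ X)
    (hi' : ∀ q, IsClosedImmersion (Hom.toSchemeHom (i' q))) (hdesc' : IsIsogeny (biproduct.desc i')) (q : Q) :
    ∃! g : Y q ⟶ Y' q, g ≫ i' q = i q ∧ IsIso g := by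
  obtain ⟨e, he⟩ := exists_iso_isotypicComponents_comp_eq hB hB0 hni hY i hi hdesc hY' i' hi' hdesc' q
  haveI := hi' q
  haveI := mono_of_isClosedImmersion_toSchemeHom (i' q)
  refine ⟨e.hom, ⟨he, inferInstance⟩, fun g hg ↦ ?_⟩
  rw [← cancel_mono (i' q), hg.1, he]

omit [Fintype Q] in
/-- Components of ISOGENOUS types in two systems of isotypic components indexed by two lists of simple types
`B : Q → _`, `B' : Q' → _` agree: if `B_q ∼ B'_{q'}` then `Y_q ≅ Y'_{q'}` over `X` (perfect field).
[cite: SilverbergZarhin2015, Lemma 3.1, Def. 3.2 and proof of Lemma 3.3 (p. 5)] [cite: MumfordAV1970, §19 Cor. 1 of Thm. 1 (p. 173)] -/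
theorem exists_iso_isotypicComponents_comp_eq_of_isIsogenous [Fintype Q] {Q' : Type} [Fintype Q']
    {B' : Q' → Motives.AbelianVariety K} {n' : Q' → ℕ} {Y' : Q' → Motives.AbelianVariety K}
    (hB : ∀ q, (B q).IsSimple) (hB0 : ∀ q, 0 < (B q).dim) (hni : ∀ q q', q ≠ q' → ¬ IsIsogenous (B q) (B q'))
    (hY : ∀ q, IsIsogenous (Y q) (⨁ fun _ : Fin (n q + 1) ↦ B q)) (i : ∀ q, Y q ⟶ X)
    (hi : ∀ q, IsClosedImmersion (Hom.toSchemeHom (i q))) (hdesc : IsIsogeny (biproduct.desc i))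
    (hB' : ∀ q, (B' q).IsSimple) (hB0' : ∀ q, 0 < (B' q).dim) (hni' : ∀ q q', q ≠ q' → ¬ IsIsogenous (B' q) (B' q'))
    (hY' : ∀ q, IsIsogenous (Y' q) (⨁ fun _ : Fin (n' q + 1) ↦ B' q)) (i' : ∀ q, Y' q ⟶ X)
    (hi' : ∀ q, IsClosedImmersion (Hom.toSchemeHom (i' q))) (hdesc' : IsIsogeny (biproduct.desc i'))
    {q : Q} {q' : Q'} (hqq' : IsIsogenous (B q) (B' q')) : ∃ e : Y q ≅ Y' q', e.hom ≫ i' q' = i q := by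
  haveI := hi q
  haveI := hi' q'
  -- `Y'_{q'}` is of type `B_q` and `Y_q` is of type `B'_{q'}`
  obtain ⟨f, hf⟩ := exists_isIsogeny_biproduct_map_of_isIsogenous (F := fun _ : Fin (n' q' + 1) ↦ B' q')
    (G := fun _ : Fin (n' q' + 1) ↦ B q) fun _ ↦ hqq'.symm'
  obtain ⟨f', hf'⟩ := exists_isIsogeny_biproduct_map_of_isIsogenous (F := fun _ : Fin (n q + 1) ↦ B q)
    (G := fun _ : Fin (n q + 1) ↦ B' q') fun _ ↦ hqq'
  have hY'q : IsIsogenous (Y' q') (⨁ fun _ : Fin (n' q' + 1) ↦ B q) := (hY' q').trans ⟨_, hf⟩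
  have hYq : IsIsogenous (Y q) (⨁ fun _ : Fin (n q + 1) ↦ B' q') := (hY q).trans ⟨_, hf'⟩
  exact exists_iso_of_range_eq (i q) (i' q')
    ((range_subset_range_isotypicComponent hB' hB0' hni' hY' i' hi' hdesc' hYq (i q)).antisymm
      (range_subset_range_isotypicComponent hB hB0 hni hY i hi hdesc hY'q (i' q')))

/-! ## §4 The intrinsic description: `Y_q` is the sum of the images of all homomorphisms `B_q → X` -/

/-- Every homomorphism `f : B_q → X` lands in the isotypic component `Y_q`: `range f ⊆ range i_q` (perfect field).
[cite: SilverbergZarhin2015, Def. 2.2–2.3 (p. 3) and proof of Lemma 3.3 (p. 5)] [cite: MumfordAV1970, §19 Cor. 1–2 of Thm. 1 (pp. 173–174)] -/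
theorem range_subset_range_isotypicComponent_of_hom (hB : ∀ q, (B q).IsSimple) (hB0 : ∀ q, 0 < (B q).dim)
    (hni : ∀ q q', q ≠ q' → ¬ IsIsogenous (B q) (B q'))
    (hY : ∀ q, IsIsogenous (Y q) (⨁ fun _ : Fin (n q + 1) ↦ B q)) (i : ∀ q, Y q ⟶ X)
    (hi : ∀ q, IsClosedImmersion (Hom.toSchemeHom (i q))) (hdesc : IsIsogeny (biproduct.desc i)) {q : Q}
    (f : B q ⟶ X) : Set.range (Hom.toSchemeHom f) ⊆ Set.range (Hom.toSchemeHom (i q)) := by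
  obtain ⟨g, hg, -⟩ := existsUnique_hom_comp_isotypicComponent_eq_of_isIsogenous hB hB0 hni hY i hi hdesc
    (IsIsogenous.refl (B q)) f
  exact range_toSchemeHom_subset_of_comp_eq (i q) f g hg

/-- The addition map `⨁_l B_q → X` of ANY finite family `f_l : B_q → X` lands in `Y_q`: its range is contained in
`range i_q` (it factors through `i_q` summand by summand). [cite: SilverbergZarhin2015, Def. 2.3 and proof of Lemma 3.3 (p. 5)]
[cite: MumfordAV1970, §19 Thm. 1 and Cor. 1–2 (pp. 173–174)] -/
theorem range_biproduct_desc_subset_range_isotypicComponent {ι : Type} [Fintype ι] (hB : ∀ q, (B q).IsSimple)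
    (hB0 : ∀ q, 0 < (B q).dim) (hni : ∀ q q', q ≠ q' → ¬ IsIsogenous (B q) (B q'))
    (hY : ∀ q, IsIsogenous (Y q) (⨁ fun _ : Fin (n q + 1) ↦ B q)) (i : ∀ q, Y q ⟶ X)
    (hi : ∀ q, IsClosedImmersion (Hom.toSchemeHom (i q))) (hdesc : IsIsogeny (biproduct.desc i)) {q : Q}
    (f : ι → (B q ⟶ X)) :
    Set.range (Hom.toSchemeHom (biproduct.desc f)) ⊆ Set.range (Hom.toSchemeHom (i q)) := by
  haveI := hi q
  have h : ∀ l, ∃ g : B q ⟶ Y q, g ≫ i q = f l := fun l ↦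
    (existsUnique_hom_comp_isotypicComponent_eq_of_isIsogenous hB hB0 hni hY i hi hdesc (IsIsogenous.refl (B q))
      (f l)).exists
  obtain ⟨g, hg⟩ := (exists_comp_eq_biproduct_desc_iff f (i q)).2 h
  exact range_toSchemeHom_subset_of_comp_eq (i q) _ g hg

/-- **`range i_q = range (⨁_l B_q → X)` for every finite family `f_l : B_q → X` spanning `Hom(B_q, X)` over `ℤ`**
(perfect field).  `⊇` is the previous theorem; for `⊆`, an isogeny `e : ⨁_{k ≤ n_q} B_q → Y_q` has
`ι_k ≫ e ≫ i_q = Σ_l a_{kl} f_l`, so `e ≫ i_q = M ≫ desc f` for the integer matrix `M = (a_{kl} • 𝟙)`, and `e` is surjective.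
[cite: SilverbergZarhin2015, Def. 2.3 and proof of Lemma 3.3 (p. 5)] [cite: MumfordAV1970, §19 Thm. 1, Cor. 1–2 and Remark p. 169 (pp. 169–174)]
[cite: Milne1986AbelianVarieties, §12 Prop. 12.1 and p. 122 (PDF p. 189)] -/
theorem range_isotypicComponent_eq_range_biproduct_desc_of_span_eq_top {ι : Type} [Fintype ι]
    (hB : ∀ q, (B q).IsSimple) (hB0 : ∀ q, 0 < (B q).dim) (hni : ∀ q q', q ≠ q' → ¬ IsIsogenous (B q) (B q'))
    (hY : ∀ q, IsIsogenous (Y q) (⨁ fun _ : Fin (n q + 1) ↦ B q)) (i : ∀ q, Y q ⟶ X)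
    (hi : ∀ q, IsClosedImmersion (Hom.toSchemeHom (i q))) (hdesc : IsIsogeny (biproduct.desc i)) {q : Q}
    (f : ι → (B q ⟶ X)) (hf : Submodule.span ℤ (Set.range f) = ⊤) :
    Set.range (Hom.toSchemeHom (i q)) = Set.range (Hom.toSchemeHom (biproduct.desc f)) := by
  classical
  refine Set.Subset.antisymm ?_ (range_biproduct_desc_subset_range_isotypicComponent hB hB0 hni hY i hi hdesc f)
  obtain ⟨e, he⟩ := (hY q).symm'
  -- the homomorphisms `ι_k ≫ e ≫ i_q : B_q → X` are integer combinations of the `f_l`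
  have hmem : ∀ k : Fin (n q + 1), ∃ c : ι → ℤ, ∑ l, c l • f l = biproduct.ι _ k ≫ e ≫ i q := fun k ↦
    (Submodule.mem_span_range_iff_exists_fun ℤ).1 (by rw [hf]; exact Submodule.mem_top)
  choose c hc using hmem
  have hfac : e ≫ i q = biproduct.matrix (fun k l ↦ c k l • 𝟙 (B q)) ≫ biproduct.desc f := by
    refine biproduct.hom_ext' _ _ fun k ↦ ?_
    rw [biproduct.ι_matrix_assoc, biproduct.lift_desc, ← hc k]
    exact (Finset.sum_congr rfl fun l _ ↦ by rw [Preadditive.zsmul_comp, Category.id_comp]).symm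
  haveI : Surjective (Hom.toSchemeHom e) := he.1
  rw [← range_toSchemeHom_comp_eq_of_surjective e (i q), hfac]
  exact range_toSchemeHom_comp_subset _ _

/-- **`Y_q ≅ im(⨁_l B_q → X)` over `X` for every finite family `f_l : B_q → X` spanning `Hom(B_q, X)` over `ℤ`**: the
isotypic component is the image of the addition map of a spanning family (perfect field).
[cite: SilverbergZarhin2015, Def. 2.2–2.3 (p. 3) and proof of Lemma 3.3 (p. 5)] [cite: MumfordAV1970, §19 Thm. 1 and Cor. 1–2 (pp. 173–174)]
[cite: Milne1986AbelianVarieties, §12 p. 122 (PDF p. 189)] -/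
theorem exists_iso_image_biproduct_desc_isotypicComponent {ι : Type} [Fintype ι] (hB : ∀ q, (B q).IsSimple)
    (hB0 : ∀ q, 0 < (B q).dim) (hni : ∀ q q', q ≠ q' → ¬ IsIsogenous (B q) (B q'))
    (hY : ∀ q, IsIsogenous (Y q) (⨁ fun _ : Fin (n q + 1) ↦ B q)) (i : ∀ q, Y q ⟶ X)
    (hi : ∀ q, IsClosedImmersion (Hom.toSchemeHom (i q))) (hdesc : IsIsogeny (biproduct.desc i)) {q : Q}
    (f : ι → (B q ⟶ X)) (hf : Submodule.span ℤ (Set.range f) = ⊤) :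
    ∃ e : Y q ≅ image (biproduct.desc f), e.hom ≫ imageι (biproduct.desc f) = i q := by
  haveI := hi q
  exact exists_iso_image_of_range_eq (i q) (biproduct.desc f)
    (range_isotypicComponent_eq_range_biproduct_desc_of_span_eq_top hB hB0 hni hY i hi hdesc f hf)

/-- **THE INTRINSIC DESCRIPTION OF THE ISOTYPIC COMPONENT**: `Y_q` is the sum `Σ_f f(B_q)` of the images of all
homomorphisms `B_q → X` — precisely, there is a finite family `f_l : B_q → X` (`l < m`; any `ℤ`-spanning family of the
finitely generated group `Hom(B_q, X)` will do) with `Y_q ≅ im(⨁_{l<m} B_q → X)` over `X` (perfect field).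
[cite: SilverbergZarhin2015, Def. 2.2–2.3 (p. 3) and proof of Lemma 3.3 (p. 5)] [cite: MumfordAV1970, §19 Thm. 1, Cor. 1–2 and Thm. 3 (pp. 173–176)]
[cite: Milne1986AbelianVarieties, §12 Prop. 12.1 and p. 122 (PDF p. 189)] -/
theorem exists_fin_iso_image_biproduct_desc_isotypicComponent (hB : ∀ q, (B q).IsSimple) (hB0 : ∀ q, 0 < (B q).dim)
    (hni : ∀ q q', q ≠ q' → ¬ IsIsogenous (B q) (B q'))
    (hY : ∀ q, IsIsogenous (Y q) (⨁ fun _ : Fin (n q + 1) ↦ B q)) (i : ∀ q, Y q ⟶ X)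
    (hi : ∀ q, IsClosedImmersion (Hom.toSchemeHom (i q))) (hdesc : IsIsogeny (biproduct.desc i)) (q : Q) :
    ∃ (m : ℕ) (f : Fin m → (B q ⟶ X)), Nonempty {e : Y q ≅ image (biproduct.desc f) //
      e.hom ≫ imageι (biproduct.desc f) = i q} := by
  haveI : Module.Finite ℤ (B q ⟶ X) := module_finite_hom_holds (B q) X
  obtain ⟨m, f, hf⟩ := Module.Finite.exists_fin (R := ℤ) (M := (B q ⟶ X))
  obtain ⟨e, he⟩ := exists_iso_image_biproduct_desc_isotypicComponent hB hB0 hni hY i hi hdesc f hf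
  exact ⟨m, f, ⟨⟨e, he⟩⟩⟩

end Perfect

end AbelianVariety

end Literature.AlgebraicGeometry.HodgeTheory

end
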